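import Mathlib.Algebra.Order.Archimedean.Basic
import Mathlib.Data.NNRat.Order
import Mathlib.Data.NNReal.Defs
import Literature.AlgebraicGeometry.Frobenioids.Monoids
import HarnessLib

/-!
# Frobenioids I, Theorem 4.2 (iii): order- and power-compatible bijections of monoprime monoids are isomorphisms

Mochizuki, *The geometry of Frobenioids I: the general theory*, Kyushu J. Math. **62** (2008)
293–400, §4, Theorem 4.2 (iii), proof, kurims p. 81 [cite: MochizukiFrdI2008, Thm. 4.2 (iii) p.81]:
"… bijections of sets `Φ₁(A₁)_𝔭₁ ≅ Φ₂(A₂)_𝔭₂` that are compatible both with '`≤`' and with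
multiplication by elements of `ℕ_{≥1}` … in light of the well-known structure of the monoids `ℚ_{≥0}`,
`ℝ_{≥0}` [cf. Definition 2.4, (i), (b)], this is enough to conclude that these bijections of sets are,
in fact, isomorphisms of monoids."

PROOF-ONLY file (the "monoid kernel" of [FrdI] Thm. 4.2 (iii); PIECE requested by seat abc-iut-L1-t14,
2026-08-25T21:38:21Z, for its `Thm42iii`; author abc-iut-L1-d10). MAIN RESULT
`IsMonoprime.map_mul_of_dvd_iff_of_pow`: a bijection `f : P ≃ Q` of monoprime monoids
(`P, Q ≅ ℤ_{≥0}, ℚ_{≥0}` or `ℝ_{≥0}`, [FrdI] §0 p. 10) compatible with divisibility (`≤`) and with all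
`n`-th power maps, `n ≥ 1`, is multiplicative. The proof is uniform in the nine combinations of monoid
types: transported to the additive models it is the statement (`addHom_of_monotone_of_nsmul`) that a
MONOTONE map `g : Λ₁ → Λ₂` between archimedean, canonically and linearly ordered, cancellative additive
monoids with `g (n • a) = n • g a` (`n ≥ 1`) is additive — for `a > 0` and every `m ≥ 1` one picks `k`
with `k • a ≤ m • b ≤ (k + 1) • a`, whence both `m • g (a + b)` and `m • (g a + g b)` lie in the interval
`[(m + k) • g a, (m + k + 1) • g a]`; two elements all of whose multiples differ by at most `g a` are
equal (archimedean property). Only the direction "`x ∣ y ⇒ f x ∣ f y`" of the order-compatibility is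
used, and bijectivity only enters through the statement. No definitions.
-/

namespace Literature.AlgebraicGeometry.Frobenioids

open Function

/-! ### The additive kernel: monotone `ℕ_{≥1}`-homogeneous maps of archimedean ordered monoids are additive -/

section Additive

variable {Λ₁ Λ₂ : Type*}
  [AddCommMonoid Λ₁] [LinearOrder Λ₁] [CanonicallyOrderedAdd Λ₁] [IsOrderedCancelAddMonoid Λ₁]
  [Archimedean Λ₁]
  [AddCommMonoid Λ₂] [LinearOrder Λ₂] [CanonicallyOrderedAdd Λ₂] [IsOrderedCancelAddMonoid Λ₂]
  [Archimedean Λ₂]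

/-- In an archimedean, canonically and linearly ordered cancellative monoid, two elements `u, v` with
`m • u ≤ m • v + c` and `m • v ≤ m • u + c` for all `m` are equal. [folklore] -/
private theorem eq_of_forall_nsmul_le_add {u v c : Λ₂} (h₁ : ∀ m : ℕ, m • u ≤ m • v + c)
    (h₂ : ∀ m : ℕ, m • v ≤ m • u + c) : u = v := by
  -- the asymmetric half: `u ≤ v` and "all multiples of `v` exceed those of `u` by at most `c`" give `u = v`
  have key : ∀ {u v : Λ₂}, (∀ m : ℕ, m • v ≤ m • u + c) → u ≤ v → u = v := by
    intro u v h huv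
    obtain ⟨d, rfl⟩ := le_iff_exists_add.mp huv
    by_contra hne
    have hd : 0 < d := by
      rcases eq_or_lt_of_le (zero_le (a := d)) with h0 | h0
      · exact (hne (by rw [← h0, add_zero])).elim
      · exact h0
    obtain ⟨n, hn⟩ := Archimedean.arch (c + d) hd
    have h' : n • u + n • d ≤ n • u + c := by rw [← nsmul_add]; exact h n
    have h'' : n • d ≤ c := le_of_add_le_add_left h'
    have hcd : c + d ≤ c + 0 := by rw [add_zero]; exact hn.trans h''
    exact absurd (le_antisymm (le_of_add_le_add_left hcd) zero_le) hd.ne'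
  rcases le_total u v with huv | hvu
  · exact key h₂ huv
  · exact (key h₁ hvu).symm

/-- "Division with remainder" in an archimedean canonically linearly ordered monoid: for `a > 0` and any
`x` there is `k ∈ ℕ` with `k • a ≤ x ≤ (k + 1) • a`. [folklore] -/
private theorem exists_nsmul_le_le_succ_nsmul {a : Λ₁} (ha : 0 < a) (x : Λ₁) :
    ∃ k : ℕ, k • a ≤ x ∧ x ≤ (k + 1) • a := by
  classical
  have hex : ∃ k : ℕ, x ≤ (k + 1) • a := by
    obtain ⟨K, hK⟩ := Archimedean.arch x ha
    exact ⟨K, hK.trans (nsmul_le_nsmul_left zero_le (Nat.le_succ K))⟩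
  refine ⟨Nat.find hex, ?_, Nat.find_spec hex⟩
  rcases Nat.eq_zero_or_pos (Nat.find hex) with h0 | hpos
  · rw [h0, zero_nsmul]; exact zero_le
  · obtain ⟨k', hk'⟩ := Nat.exists_eq_succ_of_ne_zero hpos.ne'
    have hmin := Nat.find_min hex (show k' < Nat.find hex by omega)
    rw [hk']
    exact le_of_lt (not_le.mp hmin)

/-- A monotone map `g : Λ₁ → Λ₂` of archimedean, canonically and linearly ordered, cancellative additive
monoids with `g (n • a) = n • g a` for all `n ≥ 1` is ADDITIVE (the additive form of the "well-known
structure of the monoids `ℚ_{≥0}`, `ℝ_{≥0}`" step of [FrdI] Thm. 4.2 (iii), p. 81; it covers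
`ℤ_{≥0}`, `ℚ_{≥0}`, `ℝ_{≥0}` and any pair of them at once). [cite: MochizukiFrdI2008, Thm. 4.2 (iii) p.81] -/
theorem addHom_of_monotone_of_nsmul (g : Λ₁ → Λ₂) (hmono : ∀ a b, a ≤ b → g a ≤ g b)
    (hns : ∀ (a : Λ₁) (n : ℕ), 0 < n → g (n • a) = n • g a) (a b : Λ₁) :
    g (a + b) = g a + g b := by
  -- `g 0 = 0`, so the homogeneity holds for `n = 0` as well
  have h0 : g 0 = 0 := by
    have h := hns 0 2 two_pos
    rw [nsmul_zero, two_nsmul] at h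
    have h' : g 0 + g 0 = g 0 + 0 := by rw [add_zero]; exact h.symm
    exact add_left_cancel h'
  have hns' : ∀ (x : Λ₁) (n : ℕ), g (n • x) = n • g x := fun x n => by
    rcases Nat.eq_zero_or_pos n with rfl | hn
    · rw [zero_nsmul, zero_nsmul, h0]
    · exact hns x n hn
  rcases eq_or_lt_of_le (zero_le (a := a)) with ha | ha
  · rw [← ha, zero_add, h0, zero_add]
  -- for `a > 0`: all multiples of `g (a + b)` and `g a + g b` differ by at most `g a`
  have main : ∀ m : ℕ,
      m • g (a + b) ≤ m • (g a + g b) + g a ∧ m • (g a + g b) ≤ m • g (a + b) + g a := by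
    intro m
    obtain ⟨k, hk₁, hk₂⟩ := exists_nsmul_le_le_succ_nsmul ha (m • b)
    have e₁ : (m + k) • a ≤ m • (a + b) := by
      rw [add_nsmul, nsmul_add]; exact add_le_add le_rfl hk₁
    have e₂ : m • (a + b) ≤ (m + k + 1) • a := by
      rw [add_assoc, add_nsmul, nsmul_add]; exact add_le_add le_rfl hk₂
    have hI₁ : (m + k) • g a ≤ m • g (a + b) := by
      rw [← hns', ← hns']; exact hmono _ _ e₁
    have hI₂ : m • g (a + b) ≤ (m + k + 1) • g a := by
      rw [← hns', ← hns']; exact hmono _ _ e₂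
    have hJ₁ : (m + k) • g a ≤ m • (g a + g b) := by
      rw [nsmul_add, add_nsmul, ← hns' b m, ← hns' a k]; exact add_le_add le_rfl (hmono _ _ hk₁)
    have hJ₂ : m • (g a + g b) ≤ (m + k + 1) • g a := by
      rw [nsmul_add, add_assoc, add_nsmul, ← hns' b m, ← hns' a (k + 1)]
      exact add_le_add le_rfl (hmono _ _ hk₂)
    have hs : (m + k + 1) • g a = (m + k) • g a + g a := succ_nsmul _ _
    exact ⟨hI₂.trans (by rw [hs]; exact add_le_add hJ₁ le_rfl),
      hJ₂.trans (by rw [hs]; exact add_le_add hI₁ le_rfl)⟩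
  exact eq_of_forall_nsmul_le_add (fun m => (main m).1) (fun m => (main m).2)

end Additive

/-! ### Transport to monoprime monoids -/

section Transport

variable {P Q : Type*} [CommMonoid P] [CommMonoid Q]

/-- Divisibility in `Multiplicative Λ` is the order of the canonically ordered `Λ`. [folklore] -/
private theorem multiplicative_dvd_iff {Λ : Type*} [AddCommMonoid Λ] [PartialOrder Λ]
    [CanonicallyOrderedAdd Λ] (x y : Multiplicative Λ) :
    x ∣ y ↔ Multiplicative.toAdd x ≤ Multiplicative.toAdd y := by
  constructor
  · rintro ⟨c, rfl⟩
    exact le_iff_exists_add.mpr ⟨Multiplicative.toAdd c, toAdd_mul x c⟩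
  · intro h
    obtain ⟨c, hc⟩ := le_iff_exists_add.mp h
    exact ⟨Multiplicative.ofAdd c, Multiplicative.toAdd.injective (by rw [toAdd_mul, toAdd_ofAdd, hc])⟩

/-- The monoid kernel of Thm. 4.2 (iii) for given additive models `P ≅ Λ₁`, `Q ≅ Λ₂` (each `Λᵢ` one of
`ℤ_{≥0}, ℚ_{≥0}, ℝ_{≥0}`, or any archimedean canonically linearly ordered cancellative monoid): a map
`f : P → Q` with `x ∣ y ⇒ f x ∣ f y` and `f (x ^ n) = (f x) ^ n` (`n ≥ 1`) is multiplicative.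
[cite: MochizukiFrdI2008, Thm. 4.2 (iii) p.81] -/
theorem map_mul_of_dvd_of_pow_of_mulEquiv {Λ₁ Λ₂ : Type*}
    [AddCommMonoid Λ₁] [LinearOrder Λ₁] [CanonicallyOrderedAdd Λ₁] [IsOrderedCancelAddMonoid Λ₁]
    [Archimedean Λ₁]
    [AddCommMonoid Λ₂] [LinearOrder Λ₂] [CanonicallyOrderedAdd Λ₂] [IsOrderedCancelAddMonoid Λ₂]
    [Archimedean Λ₂]
    (e₁ : P ≃* Multiplicative Λ₁) (e₂ : Q ≃* Multiplicative Λ₂) (f : P → Q)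
    (hdvd : ∀ x y : P, x ∣ y → f x ∣ f y)
    (hpow : ∀ (x : P) (n : ℕ), 0 < n → f (x ^ n) = f x ^ n) (x y : P) :
    f (x * y) = f x * f y := by
  -- the transported map `g : Λ₁ → Λ₂`
  let g : Λ₁ → Λ₂ := fun a => Multiplicative.toAdd (e₂ (f (e₁.symm (Multiplicative.ofAdd a))))
  have hg : ∀ z : P, Multiplicative.toAdd (e₂ (f z)) = g (Multiplicative.toAdd (e₁ z)) := fun z => by
    simp only [g, ofAdd_toAdd, MulEquiv.symm_apply_apply]
  have hmono : ∀ a b, a ≤ b → g a ≤ g b := fun a b hab => by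
    have h1 : e₁.symm (Multiplicative.ofAdd a) ∣ e₁.symm (Multiplicative.ofAdd b) :=
      map_dvd e₁.symm ((multiplicative_dvd_iff _ _).mpr hab)
    exact (multiplicative_dvd_iff _ _).mp (map_dvd e₂ (hdvd _ _ h1))
  have hns : ∀ (a : Λ₁) (n : ℕ), 0 < n → g (n • a) = n • g a := fun a n hn => by
    simp only [g]
    rw [ofAdd_nsmul, map_pow, hpow _ n hn, map_pow, toAdd_pow]
  have key := addHom_of_monotone_of_nsmul g hmono hns (Multiplicative.toAdd (e₁ x))
    (Multiplicative.toAdd (e₁ y))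
  rw [← toAdd_mul, ← map_mul, ← hg, ← hg, ← hg, ← toAdd_mul, ← map_mul] at key
  exact e₂.injective (Multiplicative.toAdd.injective key)

/-- **[FrdI] Thm. 4.2 (iii), monoid kernel** (p. 81): a bijection of sets `f : P ≅ Q` between monoprime
monoids (`≅ ℤ_{≥0}, ℚ_{≥0}, ℝ_{≥0}`) "compatible both with '`≤`' [divisibility] and with multiplication
by elements of `ℕ_{≥1}`" [the `n`-th power maps] is "in fact, [an] isomorphism of monoids": it is
multiplicative. (Signature requested by seat abc-iut-L1-t14 for `Thm42iii`; all nine combinations of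
monoid types are covered by one archimedean squeeze argument, `addHom_of_monotone_of_nsmul`.)
[cite: MochizukiFrdI2008, Thm. 4.2 (iii) p.81] -/
theorem IsMonoprime.map_mul_of_dvd_iff_of_pow (hP : IsMonoprime P) (hQ : IsMonoprime Q) (f : P ≃ Q)
    (hdvd : ∀ x y : P, x ∣ y ↔ f x ∣ f y)
    (hpow : ∀ (x : P) (n : ℕ+), f (x ^ (n : ℕ)) = f x ^ (n : ℕ)) :
    ∀ x y : P, f (x * y) = f x * f y := by
  have hdvd' : ∀ x y : P, x ∣ y → f x ∣ f y := fun x y => (hdvd x y).mp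
  have hpow' : ∀ (x : P) (n : ℕ), 0 < n → f (x ^ n) = f x ^ n := fun x n hn => hpow x ⟨n, hn⟩
  intro x y
  rcases hP with ⟨⟨⟨e₁⟩⟩⟩ | ⟨⟨⟨e₁⟩⟩⟩ | ⟨⟨⟨e₁⟩⟩⟩ <;> rcases hQ with ⟨⟨⟨e₂⟩⟩⟩ | ⟨⟨⟨e₂⟩⟩⟩ | ⟨⟨⟨e₂⟩⟩⟩
  all_goals exact map_mul_of_dvd_of_pow_of_mulEquiv e₁ e₂ f hdvd' hpow' x y

/-- The isomorphism of monoids packaged from Thm. 4.2 (iii)'s monoid kernel. [cite: MochizukiFrdI2008, Thm. 4.2 (iii) p.81] -/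
theorem IsMonoprime.nonempty_mulEquiv_of_dvd_iff_of_pow (hP : IsMonoprime P) (hQ : IsMonoprime Q)
    (f : P ≃ Q) (hdvd : ∀ x y : P, x ∣ y ↔ f x ∣ f y)
    (hpow : ∀ (x : P) (n : ℕ+), f (x ^ (n : ℕ)) = f x ^ (n : ℕ)) :
    ∃ e : P ≃* Q, ∀ x, e x = f x :=
  ⟨{ f with map_mul' := hP.map_mul_of_dvd_iff_of_pow hQ f hdvd hpow }, fun _ => rfl⟩

end Transport

end Literature.AlgebraicGeometry.Frobenioids
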